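import Summits.Ventures.PercRepro.S2SharpCoreXQICTQ5
import Summits.Ventures.PercRepro.S2CellsP18A
import Summits.Ventures.PercRepro.S1CoreCapChain
import Summits.Ventures.PercRepro.S1FiveCircuitBase
import Summits.Ventures.PercRepro.TriangleCapEightI
import Summits.Ventures.PercRepro.RankLevelSetDeleteColoops

/-!
# PercRepro — S2: THE CELL `(18, 7)` — THE COLOOP-FREE CASE ON THE `m = 25` CAP, THE COLOOP CASE BY ONE DELETION (p7, gen 7; sub-claim S2; the «19» kit)

The cell `(18, 7)` reads `1.056` with p2's cap `s₄ ≤ 79` (the averaging recursion `s₄ ≤ ⌊m·53/(m − 4)⌋` at `m ≥ 12` non-coloops);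
it closes iff `s₄ ≤ 61`. Two cases:
* **no coloop**: every one of the `25` elements is a non-coloop, so the same recursion with `m = 25` gives `s₄ ≤ ⌊25·53/21⌋ = 63`
  (`S1.ncard_fourCircuits_sub_div_le_of_nonColoops` + `S1.le_mul_div_of_sub_div_le`), and with p2's `s₅ ≤ 401` (`S1.avgChain5b 7`)
  and p3's `s₃ ≤ 11` (`cq3 7`) the cell reads `0.987` on the quart core `c025_core_five_sharp_cell_xqictq5` (S2CellsP18A, `cellP18S7`);
* **a coloop `e`**: `#U_M(18, 5) = #U_{M ＼ e}(17, 5)` (`topCount_eq_of_isColoop_of_eRank`) and `#Y_M(18, 5) ≥ 2·#Y_{M ＼ e}(17, 5)`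
  (`midCount_eq_of_isColoop_q`), so the cell follows from the SCALED cell `(Φ(18, 5)/2)·#U_{M ＼ e}(17, 5) ≤ #Y_{M ＼ e}(17, 5)` on the
  general-weight core `c025_core_five_sharp_cell_xqictq5g` at `K = C(23, 5)` (`Φ(18, 5)/2 ≤ 2^22/C(23, 5)`), where `M ＼ e` is again
  an `e`-free core (`hfree_delete_singleton`), of rank `17` and corank `7`; with the standard caps `79 / 462` that cell reads `0.929`
  (S2CellsP18A, `cellP17S7`).
**`c025_core_five_eighteen_seven`**: the `e`-free core at level `5`, rank `18`, corank `7`. Axioms: standard.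
-/

open scoped Matroid

namespace PercRepro

namespace ThmN

open Set

variable {α : Type}

/-- **The `e`-free partitions survive the deletion of one point** (closures in `M ＼ {x}` are closures in `M` minus `x`). -/
theorem hfree_delete_singleton (M : Matroid α)
    (hfree : ∀ e ∈ M.E, ∃ A ⊆ M.E \ {e}, e ∉ M.closure A ∧ e ∉ M.closure ((M.E \ {e}) \ A)) (x : α) :
    ∀ e ∈ (M ＼ {x}).E, ∃ A ⊆ (M ＼ {x}).E \ {e},
      e ∉ (M ＼ {x}).closure A ∧ e ∉ (M ＼ {x}).closure (((M ＼ {x}).E \ {e}) \ A) := by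
  intro e he
  rw [Matroid.delete_ground] at he
  obtain ⟨A, hA, heA, heB⟩ := hfree e he.1
  refine ⟨A \ {x}, ?_, ?_, ?_⟩
  · rw [Matroid.delete_ground]
    intro z hz
    exact ⟨⟨(hA hz.1).1, hz.2⟩, (hA hz.1).2⟩
  · rw [Matroid.delete_closure_eq]
    intro h
    exact heA (M.closure_subset_closure (Set.sdiff_subset.trans Set.sdiff_subset) h.1)
  · rw [Matroid.delete_closure_eq, Matroid.delete_ground]
    intro h
    refine heB (M.closure_subset_closure ?_ h.1)
    intro z hz
    exact ⟨⟨hz.1.1.1.1, hz.1.1.2⟩, fun hzA => hz.1.2 ⟨hzA, hz.2⟩⟩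

/-- **The `e`-free core at level `5`, rank `18`, corank `7`** — the coloop-free case on the `m = 25` cap `s₄ ≤ 63` and
`s₅ ≤ 401`, the coloop case by one deletion onto the scaled cell `(17, 7)`. -/
theorem c025_core_five_eighteen_seven (M : Matroid α) [M.Finite]
    (hR : M.eRank = ((18 : ℕ) : ℕ∞)) (hn : M.E.ncard = 18 + 7)
    (hfree : ∀ e ∈ M.E, ∃ A ⊆ M.E \ {e}, e ∉ M.closure A ∧ e ∉ M.closure ((M.E \ {e}) \ A)) :
    RLS M 18 5 := by
  classical
  have hd : M.E.encard = M.eRank + ((7 : ℕ) : ℕ∞) := by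
    rw [hR, ← M.ground_finite.cast_ncard_eq, hn]
    push_cast
    ring
  have hs3 := TriangleCap.core_ncard_triangles_le_cq3 M hfree hd
  rw [show TriangleCap.cq3 7 = 11 by decide] at hs3
  by_cases hK : ∃ e, M.IsColoop e
  · -- a coloop: delete it and use the scaled cell `(17, 7)`
    obtain ⟨e, he⟩ := hK
    have heE : e ∈ M.E := he.mem_ground
    have hn' : (M ＼ {e}).E.ncard = 17 + 7 := by
      have h1 := Set.ncard_sdiff_singleton_add_one heE M.ground_finite
      rw [Matroid.delete_ground]
      omega
    have hR' : (M ＼ {e}).eRank = ((17 : ℕ) : ℕ∞) := by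
      have h1 : M.eRk ((M.E \ {e}) ∪ {e}) = M.eRk (M.E \ {e}) + ({e} : Set α).encard :=
        eRk_union_eq_of_subset_coloops Set.sdiff_subset (Set.singleton_subset_iff.2 he) Set.disjoint_sdiff_left
      rw [Set.sdiff_union_of_subset (Set.singleton_subset_iff.2 heE), ← Matroid.eRank_def, hR,
        Set.encard_singleton] at h1
      rw [Matroid.delete_eq_restrict, Matroid.eRank_restrict]
      have h2 : M.eRk (M.E \ {e}) + 1 = ((17 : ℕ) : ℕ∞) + 1 := by
        rw [← h1]; norm_num
      exact WithTop.add_right_cancel (by norm_num : (1 : ℕ∞) ≠ ⊤) h2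
    have hfree' := hfree_delete_singleton M hfree e
    have hd' : (M ＼ {e}).E.encard = (M ＼ {e}).eRank + ((7 : ℕ) : ℕ∞) := by
      rw [hR', ← (M ＼ {e}).ground_finite.cast_ncard_eq, hn']
      push_cast
      ring
    have hs3' := TriangleCap.core_ncard_triangles_le_cq3 (M ＼ {e}) hfree' hd'
    rw [show TriangleCap.cq3 7 = 11 by decide] at hs3'
    have hs4' := S1.ncard_fourCircuits_le_avgChain 7 (M ＼ {e}) hfree' hd'
    rw [S1.avgChain_values.1] at hs4'
    have hs5' : {C : Set α | (M ＼ {e}).IsCircuit C ∧ C.ncard = 5}.ncard ≤ 462 := by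
      have h5 : {C : Set α | (M ＼ {e}).IsCircuit C ∧ C.ncard = 5}.ncard ≤ (7 + 4).choose 5 :=
        Matroid.ncard_circuits_le_choose_of_encard (M ＼ {e}) hd' 4
      have h462 : (7 + 4).choose 5 = 462 := by decide
      omega
    have hΦ : phiK 18 5 / 2 ≤ (2 : ℚ) ^ (17 + 5) / ((33649 : ℕ) : ℚ) := by
      have h := phiK_le_two_pow_div 18 5
      rw [Nat.choose_symm_add] at h
      have hc : ((18 + 5).choose 5 : ℚ) = 33649 := by norm_num [Nat.choose]
      rw [hc] at h
      have e1 : (2 : ℚ) ^ (18 + 5) = 2 * 2 ^ (17 + 5) := by norm_num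
      rw [e1] at h
      push_cast
      linarith
    have key := c025_core_five_sharp_cell_xqictq5g (M ＼ {e}) 17 7 (by norm_num) (by norm_num) hR' hn' hfree'
      11 79 462 hs3' hs4' hs5' 33649 (by norm_num) (phiK 18 5 / 2) hΦ
      ⟨45, by norm_num, S2.cellP17S7_poly, S2.cellP17S7_tail⟩
    have hU := Matroid.topCount_eq_of_isColoop_of_eRank he 4 (by rw [hR])
    have hY := Matroid.midCount_eq_of_isColoop_q he (by norm_num : 4 + 1 < 17)
    rw [RLS_iff]
    rw [show (18 : ℕ) = 17 + 1 from rfl, show (5 : ℕ) = 4 + 1 from rfl, hU, hY]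
    push_cast
    have h0 : (0 : ℚ) ≤ (Matroid.levelCount (M ＼ {e}) 17 : ℚ) := by positivity
    have h0' : (0 : ℚ) ≤ (Matroid.levelCount (M ＼ {e}) (4 + 1) : ℚ) := by positivity
    linarith [key, h0, h0']
  · -- no coloop: every element is a non-coloop, `m = 25`
    push Not at hK
    have hcol : M.coloops = ∅ := by
      ext x
      simp only [Set.mem_empty_iff_false, iff_false]
      intro hx
      exact hK x ((Matroid.isColoop_iff_mem_coloops).2 hx)
    have hm : 25 ≤ (M.E \ M.coloops).ncard := by
      rw [hcol, Set.sdiff_empty, hn]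
    have hd6 : M.E.encard = M.eRank + (((6 : ℕ) : ℕ∞) + 1) := by
      rw [hd]; norm_num
    have h := S1.ncard_fourCircuits_sub_div_le_of_nonColoops M hfree hd6 (by norm_num) hm (B := 53)
      (fun M' _ hfree' hd5 => S1.ncard_fourCircuits_le_fifty_three_uncond M' hfree' (by exact_mod_cast hd5))
    have hs4 : {C : Set α | M.IsCircuit C ∧ C.ncard = 4}.ncard ≤ 63 := by
      have := S1.le_mul_div_of_sub_div_le (by norm_num : 4 < 25) h
      omega
    have hs5 := S1.ncard_fiveCircuits_le_avgChain5b 7 M hfree hd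
    rw [S1.avgChain5b_values.1] at hs5
    exact c025_core_five_sharp_cell_xqictq5 M 18 7 (by norm_num) (by norm_num) hR hn hfree 11 63 401 hs3 hs4 hs5
      ⟨29, by norm_num, S2.cellP18S7_poly, S2.cellP18S7_tail⟩

end ThmN

end PercRepro
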